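import Mathlib
import HarnessLib

/-!
# `ContinuumLegGivenGap` (stmt-QuantumFields-15828), line `Sketch`, reshape 18c: `stub_csclRate` — the lattice rate beats half the continuum rate

Support file for the crux item stmt-QuantumFields-15828 (registered glue stub `stub_csclRate` of line `Sketch`,
reshape 18c). An elementary real-variable fact used by the (CSCL) assembly: the lattice Cauchy–Schwarz bound at
level `k` decays like `exp (−μ_k σ)` with lattice shift `σ = ⌊t / a_k⌋₊`, where `a_k > 0` is the lattice
spacing (`a_k → 0`) and `μ_k` the lattice mass with `Δ₀ a_k ≤ μ_k`; the continuum statement wants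
`exp (−(Δ₀/2) t)` for each fixed `t ≥ 0`, eventually in `k`.

Proof: for `t = 0` both sides equal `1` (`⌊0⌋₊ = 0`). For `t > 0`, eventually `a_k ≤ t/2`
(`Tendsto a atTop (𝓝 0)`); then `a_k ⌊t/a_k⌋₊ > t − a_k ≥ t/2` (`Nat.lt_floor_add_one`), so
`μ_k ⌊t/a_k⌋₊ ≥ Δ₀ a_k ⌊t/a_k⌋₊ ≥ (Δ₀/2) t`, and monotonicity of `exp` finishes.

No definitions, no facts; Mathlib only. [folklore]
-/

noncomputable section

namespace Summit.QuantumFields.YangMills.Theorems.ContinuumLegGivenGap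

open Filter Topology

/-- **Floor times spacing.** For `a > 0`, `t - a < a ⌊t/a⌋₊` (from `t/a < ⌊t/a⌋₊ + 1`). [folklore] -/
theorem csclRate_floorMul (a t : ℝ) (ha : 0 < a) :
    t - a < a * ((⌊t / a⌋₊ : ℕ) : ℝ) := by
  have h : t < (((⌊t / a⌋₊ : ℕ) : ℝ) + 1) * a := (div_lt_iff₀ ha).1 (Nat.lt_floor_add_one (t / a))
  linarith

/-- **Pointwise rate comparison.** If `0 < a ≤ t/2`, `0 < Δ₀` and `Δ₀ a ≤ μ`, then
`exp (−μ ⌊t/a⌋₊) ≤ exp (−(Δ₀/2) t)`. [folklore] -/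
theorem csclRate_point (a μ Δ₀ t : ℝ) (hΔ : 0 < Δ₀) (ha : 0 < a) (hat : a ≤ t / 2)
    (hμ : Δ₀ * a ≤ μ) :
    Real.exp (-(μ * ((⌊t / a⌋₊ : ℕ) : ℝ))) ≤ Real.exp (-(Δ₀ / 2) * t) := by
  rw [Real.exp_le_exp]
  have hn : (0 : ℝ) ≤ ((⌊t / a⌋₊ : ℕ) : ℝ) := Nat.cast_nonneg _
  have h1 : t - a < a * ((⌊t / a⌋₊ : ℕ) : ℝ) := csclRate_floorMul a t ha
  have h2 : Δ₀ * a * ((⌊t / a⌋₊ : ℕ) : ℝ) ≤ μ * ((⌊t / a⌋₊ : ℕ) : ℝ) :=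
    mul_le_mul_of_nonneg_right hμ hn
  have h3 : Δ₀ * (t - a) ≤ Δ₀ * (a * ((⌊t / a⌋₊ : ℕ) : ℝ)) :=
    mul_le_mul_of_nonneg_left h1.le hΔ.le
  have h4 : 0 ≤ Δ₀ * (t / 2 - a) := mul_nonneg hΔ.le (sub_nonneg.2 hat)
  nlinarith [h2, h3, h4]

/-- **`stub_csclRate`** — the lattice rate beats half the continuum rate: with `a_k > 0`, `a_k → 0` and
`Δ₀ a_k ≤ μ_k`, for every `t ≥ 0`, eventually in `k`, `exp (−μ_k ⌊t/a_k⌋₊) ≤ exp (−(Δ₀/2) t)`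
(`a_k ⌊t/a_k⌋₊ ≥ t − a_k ≥ t/2` once `a_k ≤ t/2`; `t = 0` is trivial). [folklore] -/
theorem stub_csclRate :
    ∀ (a μ : ℕ → ℝ) (Δ₀ t : ℝ), 0 < Δ₀ → 0 ≤ t → (∀ k, 0 < a k) → Tendsto a atTop (𝓝 0) →
      (∀ k, Δ₀ * a k ≤ μ k) →
      ∀ᶠ k : ℕ in atTop, Real.exp (-(μ k * ((⌊t / a k⌋₊ : ℕ) : ℝ))) ≤ Real.exp (-(Δ₀ / 2) * t) := by
  intro a μ Δ₀ t hΔ ht ha ha0 hμ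
  rcases ht.eq_or_lt with h0 | htpos
  · -- `t = 0`: both sides are `exp 0 = 1`
    subst h0
    refine Eventually.of_forall fun k => ?_
    simp
  · -- `t > 0`: eventually `a k ≤ t / 2`
    filter_upwards [ha0.eventually (eventually_le_nhds (half_pos htpos))] with k hk
    exact csclRate_point (a k) (μ k) Δ₀ t hΔ (ha k) hk (hμ k)

end Summit.QuantumFields.YangMills.Theorems.ContinuumLegGivenGap

end
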